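import Summits.QuantumFields.BalabanUV.Beta.GAN24.ScalarZerothLetterTorus
import Summits.QuantumFields.BalabanUV.Beta.GAN24.ScalarSupLettersCubicHolds
import Summits.QuantumFields.BalabanUV.Beta.GAN24.SavgInverseUniform
import HarnessLib

/-!
# NE7SharpConstrainedGradientRow — THE SHARP BLOCK-MEAN-CONSTRAINED SCALAR GREEN'S FUNCTION `G_Q` AT `U = 1`: existence, uniqueness and the SUP ROWS of
# `G_Q`, of its multiplier and of its η-GRADIENT `∂_νG_Q`, UNIFORM in the spacing `n = η⁻¹` and in the cubic torus — by Woodbury over GAN24's penalised scalar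
# propagator `𝒢′ = (Δ + a′Π′)⁻¹` and the uniform inverse `S⁻¹ = (a′Q′𝒢′Q′*)⁻¹` (interface request NE7 G99-IR2, written by the requester)

Cell `pub-balaban`, rung (B)+1 sub-cell t4, lineage `b2b-balaban-t4-ne7-p1`, generation 99 (CRUX PROVER NE7 #1 = OWNER of BINDER row NE7).  Memo
`t4/b2b-balaban-t4-ne7-p1-g99/ROAD-G99.md` §3.7 (iii) ∕ §3.8 (A)(b): input (b) of the flat `𝒯_E(1)` sup letter and of the curved bootstrap (the flat energy-slice corrector
`λ_Z = G_Q[(1 − P_𝒦)∂^*Z]` is controlled in sup-GRADIENT by `‖∂G_Q‖_{∞→∞}`).  Filed as «INTERFACE REQUEST NE7 (G99-IR2)» in `HOME/INBOX.md` [NE7P1-G99-INBOX-4]; this file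
discharges it from LANDED GAN24 theorems BY NAME — nothing re-proved, no new estimate.

THE OBJECT (not named; stated by its equations).  On the fine torus `Tor (fine n M)` over the unit torus `Tor M`, `Q′ = B5Block118.QsOp n M` (block means, (1.20)),
`Q′* = GAN24's blkInj n M = n^d·Q′ᴴ`, `Δ = B5Action121.LapS (fine n M) n` (the η-scaled scalar Laplacian `Σ_ν ∂_νᴴ∂_ν`, `∂_ν = sdiff (fine n M) n ν`).  The SHARP constrained
problem for a source `s`: find `φ` with `Q′φ = 0` and `Δφ = s + Q′*c` for some multiplier `c` (the block-mean-zero potential of `s` corrected by block-constant charges) —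
`φ = G_Q s`.  WOODBURY: with `𝒢′ = ScalarAveragedPropagator.Gps n M a′ = (Δ + a′Π′)⁻¹` (`Π′ = Q′*Q′`, any `a′ > 0`; here `a′ = 1`) and `S = HardMinimiserOneStepSup.Savg n M a′ =
a′Q′𝒢′Q′*`:  `c = −a′·S⁻¹Q′𝒢′s`, `φ = 𝒢′(s + Q′*c)` — because `Π′φ = Q′*(Q′φ) = 0` makes `(Δ + a′Π′)φ = Δφ`.
WHAT ([folklore]; 0 def, 0 sorry; every torus for §1, CUBIC tori for the gradient row of §2 — GAN24's (L2) is cubic).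
§1 `PiS_mulVec_eq_zero_of_QsOp` (`Q′φ = 0 ⟹ Π′φ = 0`), `Savg_mulVec_eq` (`S c = a′·Q′𝒢′Q′*c`), **`sharp_eq_Gps`** (a sharp solution IS `𝒢′(s + Q′*c)`), **`sharp_multiplier_eq`**
   (its multiplier IS `−a′S⁻¹Q′𝒢′s`), **`sharp_unique`** (`Q′ψ = 0 ∧ Δψ = Q′*c ⟹ ψ = 0 ∧ c = 0`), **`exists_sharp_solution`** (for every `s` the sharp problem is solvable).
§2 **`sharp_sup_rows_cubic`** — `∃ C > 0` (a function of `d` only) such that on every cubic torus `fun _ : Fin (d+1) ⇒ N₀`, every `n ≥ 1`, for every `s` with `‖s‖_∞ ≤ b` and every sharp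
   solution `(φ, c)`: `‖c‖_∞ ≤ C·b`, `‖φ‖_∞ ≤ C·b`, and **`‖∂_νφ‖_∞ ≤ C·b` for every direction `ν`** (η-units; unit-lattice reading: `‖∇G_Q‖_{∞→∞} ≲ n = L^{k+1} = M_block`) — from
   `ScalarZerothLetterTorus.sup_Gps` (L0), `ScalarSupLettersCubicHolds.scalarSup_DivG` (L2), `SavgInverseUniform.exists_sup_Savg_inv`, `HardMinimiserOneStepSup.norm_QsOp_mulVec_le`.
HONEST FRAMING (page 1): linear algebra + three landed sup letters; constants existential (GAN24's); `U = 1`, scalar, flat; the row-decay ∕ (1.110)-localised form is NOT stated here (the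
same Woodbury over `rowDecay_Gps` ∕ `rowDecay_Savg_inv` gives it when the bootstrap asks); NOT the flat `𝒯_E(1)` letter (its third row `‖PcT∂ᴴ‖_{∞→∞}`, IR1, is not in the tree), NOT
the curved letter, NOT NE7; spine 0∕9; finite T⁴ rung (B)+1 — NOT infinite volume, NOT mass gap, NOT BetaPertH, NOT Clay.  [B5] (1.20)∕(1.26) and [B9] (3.24)–(3.25) are TEXT LOCATIONS
for the objects; nothing printed is asserted.  Continuum YM on T⁴ ⇐ BetaPertH ∧ nine spine estimates (0/9 proved); BetaPertH ⇐ (D1) ∧ (D4) ∧ CAP+tail; G-an2-4 gates asym, D1 and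
NE2/3/4.
-/

set_option autoImplicit false

open scoped BigOperators Matrix ComplexConjugate

namespace Summit.QuantumFields.BalabanUV.T4Continuum.NE7SharpConstrainedGradientRow

open Literature.MathematicalPhysics.QuantumFieldTheory.Balaban1983to89
open B5Prop11Plancherel (Tor fine)
open B5Action121 (LapS sdiff)
open B5Block118 (QsOp)
open B5Blocks16 (blockOf)
open Summit.QuantumFields.BalabanUV.T4Continuum.ScalarAveragedPropagator (DeltaPs Gps Gps_mul_DeltaPs DeltaPs_mul_Gps)
open Summit.QuantumFields.BalabanUV.T4Continuum.ScalarBlockPoincare (PiS)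
open Summit.QuantumFields.BalabanUV.Beta.GAN24.SoftMinimiserOneStepSup (blkInj blkInj_mulVec Msoft)
open Summit.QuantumFields.BalabanUV.Beta.GAN24.HardMinimiserOneStepSup (Savg isUnit_det_Savg norm_QsOp_mulVec_le)
open Summit.QuantumFields.BalabanUV.Beta.GAN24.ScalarZerothLetterTorus (sup_Gps)
open Summit.QuantumFields.BalabanUV.Beta.GAN24.ScalarSupLettersCubicHolds (scalarSup_DivG)
open Summit.QuantumFields.BalabanUV.Beta.GAN24.SavgInverseUniform (exists_sup_Savg_inv)

noncomputable section

/-! ## §1 Woodbury: the sharp solution and its multiplier through `𝒢′` and `S⁻¹` (every torus) -/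

section Algebra

variable {d : ℕ} (n : ℕ) [NeZero n] (M : Fin d → ℕ) [∀ μ, NeZero (M μ)]

/-- `Q′φ = 0 ⟹ Π′φ = 0` (`Π′ = n^d·Q′ᴴQ′`). [folklore] -/
theorem PiS_mulVec_eq_zero_of_QsOp {φ : Tor (fine n M) → ℂ} (hQ : QsOp n M *ᵥ φ = 0) : PiS n M *ᵥ φ = 0 := by
  rw [PiS, Matrix.smul_mulVec, ← Matrix.mulVec_mulVec, hQ, Matrix.mulVec_zero, smul_zero]

/-- `Q′φ = 0` and `Δφ = g` ⟹ `Δ′_{a′}φ = g`. [folklore] -/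
theorem DeltaPs_mulVec_of_QsOp (a' : ℝ) {φ g : Tor (fine n M) → ℂ} (hQ : QsOp n M *ᵥ φ = 0)
    (hL : LapS (fine n M) (n : ℂ) *ᵥ φ = g) : DeltaPs n M a' *ᵥ φ = g := by
  rw [DeltaPs, Matrix.add_mulVec, Matrix.smul_mulVec, PiS_mulVec_eq_zero_of_QsOp n M hQ, smul_zero, add_zero, hL]

/-- `S c = a′·Q′(𝒢′(Q′*c))`. [folklore] -/
theorem Savg_mulVec_eq (a' : ℝ) (c : Tor M → ℂ) :
    Savg n M a' *ᵥ c = (a' : ℂ) • (QsOp n M *ᵥ (Gps n M a' *ᵥ (blkInj n M *ᵥ c))) := by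
  rw [Savg, Msoft, ← Matrix.mulVec_mulVec, Matrix.smul_mulVec, ← Matrix.mulVec_mulVec, Matrix.mulVec_smul]

/-- **A SHARP SOLUTION IS `𝒢′(s + Q′*c)`** (`a′ > 0`): `Q′φ = 0`, `Δφ = s + Q′*c` ⟹ `φ = 𝒢′(s + Q′*c)`. [folklore] -/
theorem sharp_eq_Gps {a' : ℝ} (ha' : 0 < a') {s φ : Tor (fine n M) → ℂ} {c : Tor M → ℂ} (hQ : QsOp n M *ᵥ φ = 0)
    (hL : LapS (fine n M) (n : ℂ) *ᵥ φ = s + blkInj n M *ᵥ c) : φ = Gps n M a' *ᵥ (s + blkInj n M *ᵥ c) := by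
  rw [← DeltaPs_mulVec_of_QsOp n M a' hQ hL, Matrix.mulVec_mulVec, Gps_mul_DeltaPs n M ha', Matrix.one_mulVec]

/-- **ITS MULTIPLIER IS `−a′·S⁻¹Q′𝒢′s`** (`a′ > 0`). [folklore] -/
theorem sharp_multiplier_eq {a' : ℝ} (ha' : 0 < a') {s φ : Tor (fine n M) → ℂ} {c : Tor M → ℂ} (hQ : QsOp n M *ᵥ φ = 0)
    (hL : LapS (fine n M) (n : ℂ) *ᵥ φ = s + blkInj n M *ᵥ c) :
    c = (Savg n M a')⁻¹ *ᵥ (-((a' : ℂ) • (QsOp n M *ᵥ (Gps n M a' *ᵥ s)))) := by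
  have hφ := sharp_eq_Gps n M ha' hQ hL
  have h2 : (a' : ℂ) • (QsOp n M *ᵥ (Gps n M a' *ᵥ s)) + Savg n M a' *ᵥ c = 0 := by
    rw [Savg_mulVec_eq, ← smul_add, ← Matrix.mulVec_add, ← Matrix.mulVec_add, ← hφ, hQ, smul_zero]
  have hS : Savg n M a' *ᵥ c = -((a' : ℂ) • (QsOp n M *ᵥ (Gps n M a' *ᵥ s))) := eq_neg_of_add_eq_zero_right h2
  rw [← hS, Matrix.mulVec_mulVec, Matrix.nonsing_inv_mul _ (isUnit_det_Savg n M ha'), Matrix.one_mulVec]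

/-- **UNIQUENESS OF THE SHARP PROBLEM**: `Q′ψ = 0` and `Δψ = Q′*c` ⟹ `ψ = 0` and `c = 0` (pure algebra: `c = −S⁻¹Q′𝒢′0 = 0`, then `ψ = 𝒢′(Q′*0) = 0`). [folklore] -/
theorem sharp_unique {ψ : Tor (fine n M) → ℂ} {c : Tor M → ℂ} (hQ : QsOp n M *ᵥ ψ = 0)
    (hL : LapS (fine n M) (n : ℂ) *ᵥ ψ = blkInj n M *ᵥ c) : ψ = 0 ∧ c = 0 := by
  have hL' : LapS (fine n M) (n : ℂ) *ᵥ ψ = 0 + blkInj n M *ᵥ c := by rw [zero_add]; exact hL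
  have hc := sharp_multiplier_eq n M one_pos hQ hL'
  rw [Matrix.mulVec_zero, Matrix.mulVec_zero, smul_zero, neg_zero, Matrix.mulVec_zero] at hc
  have hψ := sharp_eq_Gps n M one_pos hQ hL'
  rw [hc, Matrix.mulVec_zero, add_zero, Matrix.mulVec_zero] at hψ
  exact ⟨hψ, hc⟩

/-- **THE SHARP PROBLEM IS SOLVABLE FOR EVERY SOURCE** (every torus, every `n`): `∃ φ c, Q′φ = 0 ∧ Δφ = s + Q′*c` — the Woodbury candidate at `a′ = 1`. [folklore] -/
theorem exists_sharp_solution (s : Tor (fine n M) → ℂ) :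
    ∃ (φ : Tor (fine n M) → ℂ) (c : Tor M → ℂ), QsOp n M *ᵥ φ = 0 ∧ LapS (fine n M) (n : ℂ) *ᵥ φ = s + blkInj n M *ᵥ c := by
  set c : Tor M → ℂ := -((Savg n M 1)⁻¹ *ᵥ (QsOp n M *ᵥ (Gps n M 1 *ᵥ s))) with hc
  set φ : Tor (fine n M) → ℂ := Gps n M 1 *ᵥ (s + blkInj n M *ᵥ c) with hφ
  have hQ : QsOp n M *ᵥ φ = 0 := by
    have h1 : QsOp n M *ᵥ (Gps n M 1 *ᵥ (blkInj n M *ᵥ c)) = Savg n M 1 *ᵥ c := by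
      rw [Savg_mulVec_eq, Complex.ofReal_one, one_smul]
    have h2 : ∀ w : Tor M → ℂ, Savg n M 1 *ᵥ ((Savg n M 1)⁻¹ *ᵥ w) = w := fun w => by
      rw [Matrix.mulVec_mulVec, Matrix.mul_nonsing_inv _ (isUnit_det_Savg n M one_pos), Matrix.one_mulVec]
    rw [hφ, Matrix.mulVec_add, Matrix.mulVec_add, h1, hc, Matrix.mulVec_neg, h2, add_neg_cancel]
  refine ⟨φ, c, hQ, ?_⟩
  have hD : DeltaPs n M 1 *ᵥ φ = s + blkInj n M *ᵥ c := by
    rw [hφ, Matrix.mulVec_mulVec, DeltaPs_mul_Gps n M one_pos, Matrix.one_mulVec]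
  have hsplit : DeltaPs n M 1 *ᵥ φ = LapS (fine n M) (n : ℂ) *ᵥ φ + ((1 : ℝ) : ℂ) • (PiS n M *ᵥ φ) := by
    rw [DeltaPs, Matrix.add_mulVec, Matrix.smul_mulVec]
  rw [← hD, hsplit, PiS_mulVec_eq_zero_of_QsOp n M hQ, smul_zero, add_zero]

end Algebra

/-! ## §2 The sup rows on cubic tori: multiplier, value and η-gradient of the sharp solution -/

/-- **THE SUP ROWS OF THE SHARP CONSTRAINED GREEN'S FUNCTION, UNIFORM IN `n` AND IN THE CUBIC TORUS**: there is `C > 0` (depending on `d` only) such that for every `n ≥ 1`, every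
cubic unit torus `fun _ : Fin (d+1) ⇒ N₀`, every source `s` with `‖s‖_∞ ≤ b` and every sharp solution `(φ, c)` (`Q′φ = 0`, `Δφ = s + Q′*c`): `‖c‖_∞ ≤ C·b`, `‖φ‖_∞ ≤ C·b` and
`‖∂_νφ‖_∞ ≤ C·b` for every direction `ν` (η-units).  Woodbury at `a′ = 1` over (L0) `sup_Gps`, (L2) `scalarSup_DivG`, `exists_sup_Savg_inv`, `norm_QsOp_mulVec_le`. [folklore] -/
theorem sharp_sup_rows_cubic (d : ℕ) :
    ∃ C : ℝ, 0 < C ∧ ∀ (n N₀ : ℕ) [NeZero n] [NeZero N₀], 1 ≤ n →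
      ∀ (s φ : Tor (fine n (fun _ : Fin (d + 1) => N₀)) → ℂ) (c : Tor (fun _ : Fin (d + 1) => N₀) → ℂ) (b : ℝ),
        (∀ y, ‖s y‖ ≤ b) → QsOp n (fun _ : Fin (d + 1) => N₀) *ᵥ φ = 0 →
        LapS (fine n (fun _ : Fin (d + 1) => N₀)) (n : ℂ) *ᵥ φ = s + blkInj n (fun _ : Fin (d + 1) => N₀) *ᵥ c →
        (∀ y, ‖c y‖ ≤ C * b) ∧ (∀ x, ‖φ x‖ ≤ C * b) ∧
          ∀ (ν : Fin (d + 1)) (x : Tor (fine n (fun _ : Fin (d + 1) => N₀))),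
            ‖(sdiff (fine n (fun _ : Fin (d + 1) => N₀)) (n : ℂ) ν *ᵥ φ) x‖ ≤ C * b := by
  obtain ⟨C₀, hC₀, hG⟩ := sup_Gps d one_pos
  obtain ⟨C₁, hC₁, hD⟩ := scalarSup_DivG (d := d) one_pos
  obtain ⟨σ, hσ, hS⟩ := exists_sup_Savg_inv d one_pos
  refine ⟨(1 + C₀ + C₁) * (1 + σ * C₀), by positivity, fun n N₀ _ _ hn s φ c b hs hQ hL => ?_⟩
  have hb : 0 ≤ b := (norm_nonneg _).trans (hs 0)
  -- the multiplier: `c = −S⁻¹Q′𝒢′s`, `‖c‖ ≤ σ·C₀·b`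
  have hc_eq := sharp_multiplier_eq n (fun _ : Fin (d + 1) => N₀) one_pos hQ hL
  have hGs : ∀ x, ‖(Gps n (fun _ : Fin (d + 1) => N₀) 1 *ᵥ s) x‖ ≤ C₀ * b := fun x => hG n _ s b hs x
  have hQGs : ∀ y, ‖(-(((1 : ℝ) : ℂ) • (QsOp n (fun _ : Fin (d + 1) => N₀) *ᵥ (Gps n (fun _ : Fin (d + 1) => N₀) 1 *ᵥ s)))) y‖ ≤ C₀ * b := by
    intro y
    rw [Pi.neg_apply, norm_neg, Complex.ofReal_one, one_smul]
    exact norm_QsOp_mulVec_le n _ _ hGs y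
  have hc : ∀ y, ‖c y‖ ≤ σ * (C₀ * b) := by
    intro y; rw [hc_eq]; exact hS n _ _ _ hQGs y
  -- the source `s + Q′*c`
  have hsrc : ∀ x, ‖(s + blkInj n (fun _ : Fin (d + 1) => N₀) *ᵥ c) x‖ ≤ (1 + σ * C₀) * b := by
    intro x
    rw [Pi.add_apply, blkInj_mulVec]
    calc ‖s x + c (blockOf n (fun _ : Fin (d + 1) => N₀) x)‖ ≤ ‖s x‖ + ‖c (blockOf n (fun _ : Fin (d + 1) => N₀) x)‖ := norm_add_le _ _
      _ ≤ b + σ * (C₀ * b) := add_le_add (hs x) (hc _)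
      _ = (1 + σ * C₀) * b := by ring
  have hφ_eq := sharp_eq_Gps n (fun _ : Fin (d + 1) => N₀) one_pos hQ hL
  have h1 : 0 ≤ (1 + σ * C₀) * b := by positivity
  have hA : σ * C₀ ≤ (1 + C₀ + C₁) * (1 + σ * C₀) := by nlinarith [mul_nonneg hσ.le hC₀.le, hC₀.le, hC₁.le]
  refine ⟨fun y => ?_, fun x => ?_, fun ν x => ?_⟩
  · calc ‖c y‖ ≤ σ * (C₀ * b) := hc y
      _ = (σ * C₀) * b := by ring
      _ ≤ (1 + C₀ + C₁) * (1 + σ * C₀) * b := mul_le_mul_of_nonneg_right hA hb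
  · rw [hφ_eq]
    calc ‖(Gps n (fun _ : Fin (d + 1) => N₀) 1 *ᵥ (s + blkInj n (fun _ : Fin (d + 1) => N₀) *ᵥ c)) x‖ ≤ C₀ * ((1 + σ * C₀) * b) := hG n _ _ _ hsrc x
      _ ≤ (1 + C₀ + C₁) * ((1 + σ * C₀) * b) := mul_le_mul_of_nonneg_right (by linarith) h1
      _ = (1 + C₀ + C₁) * (1 + σ * C₀) * b := by ring
  · rw [hφ_eq]
    calc ‖(sdiff (fine n (fun _ : Fin (d + 1) => N₀)) (n : ℂ) ν *ᵥ
            (Gps n (fun _ : Fin (d + 1) => N₀) 1 *ᵥ (s + blkInj n (fun _ : Fin (d + 1) => N₀) *ᵥ c))) x‖ ≤ C₁ * ((1 + σ * C₀) * b) :=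
          hD n N₀ hn ν _ _ hsrc x
      _ ≤ (1 + C₀ + C₁) * ((1 + σ * C₀) * b) := mul_le_mul_of_nonneg_right (by linarith) h1
      _ = (1 + C₀ + C₁) * (1 + σ * C₀) * b := by ring

end

end Summit.QuantumFields.BalabanUV.T4Continuum.NE7SharpConstrainedGradientRow
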